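import Mathlib.Analysis.Complex.CauchyIntegral
import Mathlib.Analysis.SpecialFunctions.PolarCoord
import Mathlib.Analysis.SpecialFunctions.Gaussian.GaussianIntegral
import Mathlib.Analysis.SpecialFunctions.Trigonometric.ArctanDeriv
import Mathlib.Analysis.Convex.SpecificFunctions.Deriv
import Mathlib.MeasureTheory.Function.JacobianOneDim
import Mathlib.MeasureTheory.Integral.IntervalIntegral.IntegrationByParts
import Mathlib.MeasureTheory.Integral.IntegralEqImproper
import Literature.NumberTheory.EllipticCurves.PeterssonFdCoordinatesProofs
import HarnessLib

/-!
# Orbit integrals of Shintani's theta kernel: the Gaussian integral transverse to a geodesic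

Analytic core of the computation of the Fourier coefficients of Shintani's theta lift
(Shintani 1975, §2, Props. 2.3–2.4; for the tree's programme `ShintaniSchwartzFourier`,
`ShintaniThetaInversion`, `ShintaniGenusSymbols` towards Waldspurger's relation behind Tunnell's
theorem, `Literature.NumberTheory.EllipticCurves.Tunnell1983_a_sq_propto_L_one` and its even twin; endgame in
`TunnellWaldspurgerSymmetricFamilyProofs`). After unfolding the lift `∫_{Γ∖ℍ} φ(w) Θ(z, w) dμ(w)`
over the `Γ`-orbits of lattice vectors `x`, the contribution of an INDEFINITE form `x` of
discriminant `Δ > 0` is `e(z Δ) ∫_{Γ_x∖ℍ} φ(w) x(w,1) e^{-4π Im z · p_w(x)²} dμ(w)`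
(`shintaniFn`: `q_w⁺ = disc + 2 p_w²`); moving the two roots of `x` to `0, ∞` by `g ∈ SL₂(ℝ)`
(`x ∘ g = √Δ · XY`, `x(w,1) ↦ √Δ w`, `p_w(x) ↦ √Δ Re w / Im w`, `φ ↦ ψ = φ|₂g`) this is the
integral treated here, over an annulus `{1 ≤ |w| < ε²}` (a fundamental domain of the hyperbolic
stabiliser `w ↦ ε² w`) for non-square `Δ`, or over all of `ℍ` for square `Δ` (split forms, trivial
stabiliser). We PROVE, for any `ψ` and any radial set `S ⊆ (0, ∞)`:

* `integral_sectorSet_eq_integral_prod`, `integral_prod_polarIntegrand` — **polar coordinates**: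
  `∫_{Im w > 0, |w| ∈ S} ψ(w) w e^{-c (Re w/Im w)²} dμ(w) = ∫₀^π e^{-c cot²θ} sin⁻²θ R(θ) dθ`,
  `R(θ) = ∫_S ψ(re^{iθ}) e^{iθ} dr` (`dμ = du dv/v²`; the powers of `r` cancel exactly — the weight
  `2` against `x(w,1)`), via Mathlib's `Complex.integral_comp_polarCoord_symm` and Fubini;
* `integral_exp_neg_mul_cot_sq_div_sin_sq` — **`∫₀^π e^{-c cot²θ} dθ/sin²θ = √(π/c)`** (`s = cot θ`);
* `rayIntegral_eq_of_invariant` — for `ψ` holomorphic on `ℍ` with `ψ(λw) λ = ψ(w)` (`λ = r₂/r₁`: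
  the differential `ψ(w) dw` is invariant under the stabiliser), **`R(θ)` on `S = (r₁, r₂)` is
  independent of `θ`** (Cauchy's theorem on the rectangle `[log r₁, log r₂] × [θ₁, θ₂]` in
  `ζ = log w`, Mathlib's `Complex.integral_boundary_rect_eq_zero_of_differentiableOn`; the
  vertical sides cancel by invariance) — so the orbit integral only sees the CYCLE INTEGRAL
  `R(π/2) = ∫_{i r₁}^{i r₂} ψ(w) dw` along the geodesic;
* `integral_Ioi_ray_eq_of_decay` — the same on `S = (0, ∞)` for `ψ` holomorphic with the invariant
  bound `‖ψ(w)‖ Im w ≤ C` and `ψ(w) w → 0` along rays at `0` and `∞` (split forms: the cycle runs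
  from cusp to cusp; rectangles `[-T, T] × [θ₁, θ₂]`, `T → ∞`, dominated convergence);
* `integral_sectorSet_planeIntegrand_eq`, **`integral_annulus_eq_rayIntegral_mul_sqrt`**,
  `integral_sectorSet_Ioi_eq_mul_sqrt` — the assembled evaluations
  `∫ … dμ = R · √(π/c)`, with the integrability on an annulus DERIVED from the invariant bound
  (`integrableOn_polarIntegrand_annulus`: the integrand is bounded by `C K(c)/r₁`,
  `K(c) = 1 + 2/c + 2/c²` bounding `e^{-c cot²θ}/sin³θ`);
* `setIntegral_upperHalfPlane_annulus_eq` — the same as an integral over the annulus in Mathlib's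
  `UpperHalfPlane` with its invariant measure (through the tree's
  `FdCoord.setIntegral_eq_setIntegral_image`).

With `c = 4π Δ Im z` this is Shintani's `∫_{Γ_x∖ℍ} … = (cycle integral) · (4 Δ Im z)^{-1/2} / 2`-type
evaluation (the factor `Im(z)^{-1/2}` is absorbed by the weight-`3/2` normalisation of the kernel).
No named facts are introduced; definitions are the explicit integrands and the ray integral.

## References

* T. Shintani, *On construction of holomorphic cusp forms of half integral weight*, Nagoya Math. J.
  58 (1975) 83–126, §2 (Props. 2.3, 2.4: the Fourier coefficients of `θ(f)` as cycle integrals).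
  [Shintani1975]
* W. Kohnen, *Fourier coefficients of modular forms of half-integral weight*, Math. Ann. 271 (1985)
  237–268, §1 (the cycle integrals `r_{k,N}(f; D, D')`).
* S. Katok, P. Sarnak, *Heegner points, cycles and Maass forms*, Israel J. Math. 84 (1993) 193–227, §2
  (the same computation in polar coordinates about the geodesic).
-/

noncomputable section

open Real Set MeasureTheory Complex Filter Topology
open scoped Interval

namespace Literature.NumberTheory.EllipticCurves.Shintani

/-! ### Polar points and the two integrands -/

/-- The point `r e^{iθ} = r (cos θ + i sin θ)`. [folklore] -/
def polarPt (r θ : ℝ) : ℂ := (r : ℂ) * ((Real.cos θ : ℂ) + (Real.sin θ : ℂ) * I)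

/-- The unit vector `e^{iθ}`. [folklore] -/
def unitAt (θ : ℝ) : ℂ := (Real.cos θ : ℂ) + (Real.sin θ : ℂ) * I

/-- `polarPt r θ = r · e^{iθ}`. [folklore] -/
theorem polarPt_eq (r θ : ℝ) : polarPt r θ = (r : ℂ) * unitAt θ := rfl

/-- Mathlib's polar coordinates land on `polarPt`. [folklore] -/
theorem polarCoord_symm_eq_polarPt (p : ℝ × ℝ) : Complex.polarCoord.symm p = polarPt p.1 p.2 := by
  rw [Complex.polarCoord_symm_apply, polarPt]

/-- `Re (r e^{iθ}) = r cos θ`. [folklore] -/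
@[simp] theorem polarPt_re (r θ : ℝ) : (polarPt r θ).re = r * Real.cos θ := by
  simp only [polarPt, mul_re, add_re, add_im, ofReal_re, ofReal_im, mul_im, I_re, I_im]
  ring

/-- `Im (r e^{iθ}) = r sin θ`. [folklore] -/
@[simp] theorem polarPt_im (r θ : ℝ) : (polarPt r θ).im = r * Real.sin θ := by
  simp only [polarPt, mul_re, add_re, add_im, ofReal_re, ofReal_im, mul_im, I_re, I_im]
  ring

/-- `|r e^{iθ}| = |r|`. [folklore] -/
theorem norm_polarPt (r θ : ℝ) : ‖polarPt r θ‖ = |r| := by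
  rw [← polarCoord_symm_eq_polarPt (r, θ), norm_polarCoord_symm]

/-- `|e^{iθ}| = 1`. [folklore] -/
theorem norm_unitAt (θ : ℝ) : ‖unitAt θ‖ = 1 := by
  have h := norm_polarPt 1 θ
  rwa [polarPt_eq, ofReal_one, one_mul, abs_one] at h

/-- `e^{s + iθ} = e^s · e^{iθ}`. [folklore] -/
theorem exp_ofReal_add_mul_I (s θ : ℝ) : cexp ((s : ℂ) + (θ : ℂ) * I) = polarPt (Real.exp s) θ := by
  rw [Complex.exp_add_mul_I, polarPt, Complex.ofReal_exp, ← Complex.ofReal_cos, ← Complex.ofReal_sin]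

/-- The upper half-sector over a radial set `S`: `{w : Im w > 0, |w| ∈ S}`. [folklore] -/
def sectorSet (S : Set ℝ) : Set ℂ := {w | 0 < w.im ∧ ‖w‖ ∈ S}

/-- `sectorSet S` is measurable for measurable `S`. [folklore] -/
theorem measurableSet_sectorSet {S : Set ℝ} (hS : MeasurableSet S) : MeasurableSet (sectorSet S) :=
  (measurableSet_lt measurable_const Complex.measurable_im).inter (continuous_norm.measurable hS)

/-- For `-π < θ < π`: `sin θ > 0 ↔ θ ∈ (0, π)`. [folklore] -/
theorem sin_pos_iff_mem_Ioo {θ : ℝ} (h1 : -π < θ) (h2 : θ < π) : 0 < Real.sin θ ↔ θ ∈ Ioo 0 π := by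
  constructor
  · intro hs
    refine ⟨?_, h2⟩
    by_contra h
    rw [not_lt] at h
    exact absurd hs (not_lt.mpr (Real.sin_nonpos_of_nonpos_of_neg_pi_le h h1.le))
  · rintro ⟨h0, hπ⟩
    exact Real.sin_pos_of_pos_of_lt_pi h0 hπ

/-- The weighted integrand `(Im w)⁻² · ψ(w) w e^{-c (Re w / Im w)²}` on `ℂ` — the orbit integrand of
Shintani's kernel for the standard split form `XY` (`x(w,1) = w`, `p_w(x) = Re w/Im w`) against the
density `(Im w)⁻²` of the invariant measure, in the shape of the tree's
`FdCoord.setIntegral_eq_setIntegral_image`. [cite: Shintani1975, §2] -/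
def planeIntegrand (ψ : ℂ → ℂ) (c : ℝ) (w : ℂ) : ℂ :=
  ((1 / w.im ^ 2 : ℝ) : ℂ) * (ψ w * w * (Real.exp (-c * (w.re / w.im) ^ 2) : ℂ))

/-- The same integrand in polar coordinates, Jacobian included:
`e^{-c cot²θ} sin⁻²θ · ψ(r e^{iθ}) e^{iθ}`. [folklore] -/
def polarIntegrand (ψ : ℂ → ℂ) (c : ℝ) (p : ℝ × ℝ) : ℂ :=
  ((Real.exp (-c * (Real.cos p.2 / Real.sin p.2) ^ 2) / Real.sin p.2 ^ 2 : ℝ) : ℂ) *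
    (ψ (polarPt p.1 p.2) * unitAt p.2)

/-- The ray integral `R(θ) = ∫_{r₁}^{r₂} ψ(r e^{iθ}) e^{iθ} dr` (`= ∫ ψ(w) dw` along the ray segment
`arg w = θ`, `r₁ ≤ |w| ≤ r₂`). [folklore] -/
def rayIntegral (ψ : ℂ → ℂ) (θ r₁ r₂ : ℝ) : ℂ :=
  ∫ r in r₁..r₂, ψ (polarPt r θ) * unitAt θ

/-! ### Polar coordinates: the powers of `r` cancel -/

/-- Pointwise identity behind the polar substitution: for `r > 0`, `sin θ ≠ 0`,
`r · [(Im w)⁻² ψ(w) w e^{-c(Re w/Im w)²}]_{w = re^{iθ}} = e^{-c cot²θ} sin⁻²θ ψ(re^{iθ}) e^{iθ}`.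
[folklore] -/
theorem smul_planeIntegrand_polarPt (ψ : ℂ → ℂ) (c : ℝ) {r θ : ℝ} (hr : 0 < r)
    (hs : Real.sin θ ≠ 0) : r • planeIntegrand ψ c (polarPt r θ) = polarIntegrand ψ c (r, θ) := by
  rw [planeIntegrand, polarIntegrand, polarPt_re, polarPt_im, polarPt_eq]
  have hcot : r * Real.cos θ / (r * Real.sin θ) = Real.cos θ / Real.sin θ := by
    field_simp
  rw [hcot, real_smul]
  have hr' : (r : ℂ) ≠ 0 := ofReal_ne_zero.mpr hr.ne'
  have hs' : (Real.sin θ : ℂ) ≠ 0 := ofReal_ne_zero.mpr hs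
  push_cast
  field_simp

/-- **The weighted upper-half-plane integral in polar coordinates**:
`∫_{Im w>0, |w|∈S} (Im w)⁻² ψ(w) w e^{-c(Re w/Im w)²} dw = ∫∫_{S × (0,π)} e^{-c cot²θ} sin⁻²θ ψ(re^{iθ}) e^{iθ} dr dθ`
(Mathlib's `Complex.integral_comp_polarCoord_symm`; no integrability needed, both sides being `0`
in the non-integrable case). [folklore] -/
theorem integral_sectorSet_eq_integral_prod (ψ : ℂ → ℂ) (c : ℝ) {S : Set ℝ} (hS : MeasurableSet S)
    (hS0 : S ⊆ Ioi 0) :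
    ∫ w in sectorSet S, planeIntegrand ψ c w = ∫ p in S ×ˢ Ioo 0 π, polarIntegrand ψ c p := by
  rw [← MeasureTheory.integral_indicator (measurableSet_sectorSet hS),
    ← Complex.integral_comp_polarCoord_symm]
  have hsub : S ×ˢ Ioo 0 π ⊆ polarCoord.target := by
    rw [polarCoord_target]
    exact prod_mono hS0 (Ioo_subset_Ioo_left (by linarith [pi_pos]))
  rw [← inter_eq_right.mpr hsub, ← setIntegral_indicator (hS.prod measurableSet_Ioo)]
  refine setIntegral_congr_fun polarCoord.open_target.measurableSet fun p hp ↦ ?_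
  rw [polarCoord_target, mem_prod, mem_Ioi, mem_Ioo] at hp
  obtain ⟨hr, hθ1, hθ2⟩ := hp
  rw [polarCoord_symm_eq_polarPt]
  by_cases hmem : p ∈ S ×ˢ Ioo 0 π
  · rw [indicator_of_mem hmem]
    have hθ : p.2 ∈ Ioo 0 π := (mem_prod.mp hmem).2
    have hsin : 0 < Real.sin p.2 := Real.sin_pos_of_pos_of_lt_pi hθ.1 hθ.2
    have hw : polarPt p.1 p.2 ∈ sectorSet S := by
      refine ⟨?_, ?_⟩
      · rw [polarPt_im]; positivity
      · rw [norm_polarPt, abs_of_pos hr]; exact (mem_prod.mp hmem).1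
    rw [indicator_of_mem hw, smul_planeIntegrand_polarPt ψ c hr hsin.ne']
  · rw [indicator_of_notMem hmem]
    have hw : polarPt p.1 p.2 ∉ sectorSet S := by
      rintro ⟨him, hnorm⟩
      rw [polarPt_im] at him
      rw [norm_polarPt, abs_of_pos hr] at hnorm
      have hsin : 0 < Real.sin p.2 := pos_of_mul_pos_right him hr.le
      exact hmem (mem_prod.mpr ⟨hnorm, (sin_pos_iff_mem_Ioo hθ1 hθ2).mp hsin⟩)
    rw [indicator_of_notMem hw, smul_zero]

/-- **Fubini, angle outermost**: under integrability on `S × (0, π)`,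
`∫∫_{S×(0,π)} = ∫_{(0,π)} e^{-c cot²θ} sin⁻²θ (∫_S ψ(re^{iθ}) e^{iθ} dr) dθ`. [folklore] -/
theorem integral_prod_polarIntegrand (ψ : ℂ → ℂ) (c : ℝ) {S : Set ℝ}
    (hint : IntegrableOn (polarIntegrand ψ c) (S ×ˢ Ioo 0 π)) :
    ∫ p in S ×ˢ Ioo 0 π, polarIntegrand ψ c p =
      ∫ θ in Ioo 0 π, ((Real.exp (-c * (Real.cos θ / Real.sin θ) ^ 2) / Real.sin θ ^ 2 : ℝ) : ℂ) *
        ∫ r in S, ψ (polarPt r θ) * unitAt θ := by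
  have hvol : (volume : Measure (ℝ × ℝ)).restrict (S ×ˢ Ioo 0 π) =
      (volume.restrict S).prod (volume.restrict (Ioo 0 π)) := by
    rw [Measure.prod_restrict, ← Measure.volume_eq_prod]
  have hint' : Integrable (polarIntegrand ψ c)
      ((volume.restrict S).prod (volume.restrict (Ioo 0 π))) := by
    rw [← hvol]; exact hint
  rw [hvol, ← integral_prod_swap]
  change ∫ z, (polarIntegrand ψ c ∘ Prod.swap) z ∂_ = _
  rw [integral_prod _ hint'.swap]
  refine integral_congr_ae (Eventually.of_forall fun θ ↦ ?_)
  simp only [Function.comp_apply, Prod.swap_prod_mk, polarIntegrand]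
  exact integral_const_mul _ _

/-! ### The transverse Gaussian: `∫₀^π e^{-c cot²θ} dθ / sin²θ = √(π/c)` -/

/-- The parametrisation `θ = arctan y + π/2` of `(0, π)` by `ℝ` (`y = -cot θ`): its image. [folklore] -/
theorem image_arctan_add_pi_div_two : (fun y : ℝ ↦ Real.arctan y + π / 2) '' univ = Ioo 0 π := by
  ext θ
  simp only [image_univ, mem_range, mem_Ioo]
  constructor
  · rintro ⟨y, rfl⟩
    constructor
    · linarith [Real.neg_pi_div_two_lt_arctan y]
    · linarith [Real.arctan_lt_pi_div_two y]
  · rintro ⟨h0, hπ⟩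
    refine ⟨Real.tan (θ - π / 2), ?_⟩
    rw [Real.arctan_tan (by linarith) (by linarith)]
    ring

/-- `sin (arctan y + π/2) = 1/√(1+y²)`. [folklore] -/
theorem sin_arctan_add_pi_div_two (y : ℝ) : Real.sin (Real.arctan y + π / 2) = 1 / √(1 + y ^ 2) := by
  rw [Real.sin_add_pi_div_two, Real.cos_arctan]

/-- `cos (arctan y + π/2) = -y/√(1+y²)`. [folklore] -/
theorem cos_arctan_add_pi_div_two (y : ℝ) : Real.cos (Real.arctan y + π / 2) = -(y / √(1 + y ^ 2)) := by
  rw [Real.cos_add_pi_div_two, Real.sin_arctan]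

/-- **`∫₀^π e^{-c cot² θ} dθ / sin² θ = √(π/c)`**: the substitution `s = cot θ` turns it into the
Gaussian integral `∫_ℝ e^{-c s²} ds` (both sides are `0` for `c ≤ 0`, Mathlib's convention).
[folklore] -/
theorem integral_exp_neg_mul_cot_sq_div_sin_sq (c : ℝ) :
    ∫ θ in Ioo 0 π, Real.exp (-c * (Real.cos θ / Real.sin θ) ^ 2) / Real.sin θ ^ 2 = √(π / c) := by
  have himg := image_arctan_add_pi_div_two
  have hderiv : ∀ y ∈ (univ : Set ℝ),
      HasDerivWithinAt (fun y : ℝ ↦ Real.arctan y + π / 2) (1 / (1 + y ^ 2)) univ y :=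
    fun y _ ↦ ((Real.hasDerivAt_arctan y).add_const (π / 2)).hasDerivWithinAt
  have hinj : InjOn (fun y : ℝ ↦ Real.arctan y + π / 2) univ :=
    fun a _ b _ h ↦ Real.arctan_injective (add_right_cancel h)
  have key := integral_image_eq_integral_abs_deriv_smul MeasurableSet.univ hderiv hinj
    (fun θ : ℝ ↦ Real.exp (-c * (Real.cos θ / Real.sin θ) ^ 2) / Real.sin θ ^ 2)
  rw [himg] at key
  rw [key, Measure.restrict_univ, ← integral_gaussian c]
  refine integral_congr_ae (Eventually.of_forall fun y ↦ ?_)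
  have h1 : 0 < 1 + y ^ 2 := by positivity
  have hs : 0 < √(1 + y ^ 2) := sqrt_pos.mpr h1
  simp only [smul_eq_mul]
  rw [sin_arctan_add_pi_div_two, cos_arctan_add_pi_div_two, abs_of_pos (by positivity)]
  have hcot : -(y / √(1 + y ^ 2)) / (1 / √(1 + y ^ 2)) = -y := by
    field_simp
  rw [hcot, neg_sq]
  have hsin2 : (1 / √(1 + y ^ 2)) ^ 2 = 1 / (1 + y ^ 2) := by
    rw [div_pow, one_pow, sq_sqrt h1.le]
  rw [hsin2]
  field_simp

/-! ### Assembly on `ℂ`: the orbit integral sees only a ray integral -/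

/-- **If the ray integrals over `S` do not depend on the angle, the weighted integral over the
sector is that common value times `√(π/c)`.** [cite: Shintani1975, §2, Props. 2.3–2.4] -/
theorem integral_sectorSet_planeIntegrand_eq {ψ : ℂ → ℂ} {c : ℝ} {S : Set ℝ} (hS : MeasurableSet S)
    (hS0 : S ⊆ Ioi 0) (hint : IntegrableOn (polarIntegrand ψ c) (S ×ˢ Ioo 0 π)) {P : ℂ}
    (hP : ∀ θ ∈ Ioo 0 π, ∫ r in S, ψ (polarPt r θ) * unitAt θ = P) :
    ∫ w in sectorSet S, planeIntegrand ψ c w = P * (√(π / c) : ℝ) := by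
  rw [integral_sectorSet_eq_integral_prod ψ c hS hS0, integral_prod_polarIntegrand ψ c hint]
  have h1 : ∫ θ in Ioo 0 π, ((Real.exp (-c * (Real.cos θ / Real.sin θ) ^ 2) / Real.sin θ ^ 2 : ℝ) : ℂ) *
      ∫ r in S, ψ (polarPt r θ) * unitAt θ =
      ∫ θ in Ioo 0 π, ((Real.exp (-c * (Real.cos θ / Real.sin θ) ^ 2) / Real.sin θ ^ 2 : ℝ) : ℂ) * P :=
    setIntegral_congr_fun measurableSet_Ioo fun θ hθ ↦ by rw [hP θ hθ]
  rw [h1, MeasureTheory.integral_mul_const, integral_complex_ofReal,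
    integral_exp_neg_mul_cot_sq_div_sin_sq, mul_comm]

/-! ### Holomorphic differentials in log coordinates and Cauchy's theorem on rectangles -/

/-- The log-coordinate integrand `G(ζ) = ψ(e^ζ) e^ζ` (`ψ(w) dw = G(ζ) dζ`, `w = e^ζ`). [folklore] -/
def logIntegrand (ψ : ℂ → ℂ) (ζ : ℂ) : ℂ := ψ (cexp ζ) * cexp ζ

/-- `G(s + iθ) = e^s · ψ(e^s e^{iθ}) e^{iθ}`. [folklore] -/
theorem logIntegrand_ofReal_add (ψ : ℂ → ℂ) (s θ : ℝ) :
    logIntegrand ψ ((s : ℂ) + (θ : ℂ) * I) = Real.exp s • (ψ (polarPt (Real.exp s) θ) * unitAt θ) := by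
  rw [logIntegrand, exp_ofReal_add_mul_I, polarPt_eq, real_smul]
  ring

/-- `G(s + iy) = ψ(e^s e^{iy}) · e^s e^{iy}`. [folklore] -/
theorem logIntegrand_eq_comp_exp (ψ : ℂ → ℂ) (s y : ℝ) :
    logIntegrand ψ ((s : ℂ) + (y : ℂ) * I) = ψ (polarPt (Real.exp s) y) * polarPt (Real.exp s) y := by
  rw [logIntegrand, exp_ofReal_add_mul_I]

/-- `G(log r + iy) = ψ(r e^{iy}) · r e^{iy}`. [folklore] -/
theorem logIntegrand_log_add (ψ : ℂ → ℂ) {r : ℝ} (hr : 0 < r) (y : ℝ) :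
    logIntegrand ψ ((Real.log r : ℂ) + (y : ℂ) * I) = ψ (polarPt r y) * polarPt r y := by
  rw [logIntegrand_eq_comp_exp, Real.exp_log hr]

/-- **Horizontal sides are ray integrals**: `∫_{log r₁}^{log r₂} G(s + iθ) ds = R(θ)` (`r = e^s`).
[folklore] -/
theorem integral_logIntegrand_horizontal (ψ : ℂ → ℂ) (θ : ℝ) {r₁ r₂ : ℝ} (h1 : 0 < r₁)
    (h2 : 0 < r₂) :
    ∫ s in Real.log r₁..Real.log r₂, logIntegrand ψ ((s : ℂ) + (θ : ℂ) * I) =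
      rayIntegral ψ θ r₁ r₂ := by
  simp_rw [logIntegrand_ofReal_add]
  have key := intervalIntegral.integral_deriv_smul_comp_of_deriv_nonneg (a := Real.log r₁)
    (b := Real.log r₂)
    (f := Real.exp) (f' := Real.exp) (g := fun r : ℝ ↦ ψ (polarPt r θ) * unitAt θ)
    Real.continuousOn_exp (fun x _ ↦ Real.hasDerivAt_exp x) (fun x _ ↦ (Real.exp_pos x).le)
  rw [Real.exp_log h1, Real.exp_log h2] at key
  rw [rayIntegral, ← key]
  rfl

/-- The ray integral over `(0, ∞)` in log coordinates:
`∫₀^∞ ψ(re^{iθ}) e^{iθ} dr = ∫_ℝ G(s + iθ) ds`. [folklore] -/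
theorem integral_Ioi_ray_eq_integral_logIntegrand (ψ : ℂ → ℂ) (θ : ℝ) :
    ∫ r in Ioi 0, ψ (polarPt r θ) * unitAt θ = ∫ s : ℝ, logIntegrand ψ ((s : ℂ) + (θ : ℂ) * I) := by
  have hderiv : ∀ x ∈ (univ : Set ℝ), HasDerivWithinAt Real.exp (Real.exp x) univ x :=
    fun x _ ↦ (Real.hasDerivAt_exp x).hasDerivWithinAt
  have key := integral_image_eq_integral_abs_deriv_smul MeasurableSet.univ hderiv
    Real.exp_injective.injOn (fun r : ℝ ↦ ψ (polarPt r θ) * unitAt θ)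
  rw [image_univ, Real.range_exp, Measure.restrict_univ] at key
  rw [key]
  refine integral_congr_ae (Eventually.of_forall fun s ↦ ?_)
  show |Real.exp s| • _ = logIntegrand ψ _
  rw [logIntegrand_ofReal_add, abs_of_pos (Real.exp_pos s)]

/-- Integrability along the ray transfers to log coordinates. [folklore] -/
theorem integrable_logIntegrand_of_integrableOn {ψ : ℂ → ℂ} {θ : ℝ}
    (h : IntegrableOn (fun r : ℝ ↦ ψ (polarPt r θ) * unitAt θ) (Ioi 0)) :
    Integrable (fun s : ℝ ↦ logIntegrand ψ ((s : ℂ) + (θ : ℂ) * I)) := by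
  have hderiv : ∀ x ∈ (univ : Set ℝ), HasDerivWithinAt Real.exp (Real.exp x) univ x :=
    fun x _ ↦ (Real.hasDerivAt_exp x).hasDerivWithinAt
  have key := (integrableOn_image_iff_integrableOn_abs_deriv_smul MeasurableSet.univ hderiv
    Real.exp_injective.injOn (fun r : ℝ ↦ ψ (polarPt r θ) * unitAt θ))
  rw [image_univ, Real.range_exp, integrableOn_univ] at key
  have h2 := key.mp h
  refine h2.congr (Eventually.of_forall fun s ↦ ?_)
  show |Real.exp s| • _ = logIntegrand ψ _
  rw [logIntegrand_ofReal_add, abs_of_pos (Real.exp_pos s)]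

/-- `Im e^ζ = e^{Re ζ} sin (Im ζ) > 0` on the strip `0 < Im ζ < π`. [folklore] -/
theorem im_exp_pos_of_mem_strip {ζ : ℂ} (h1 : 0 < ζ.im) (h2 : ζ.im < π) : 0 < (cexp ζ).im := by
  rw [Complex.exp_im]
  exact mul_pos (Real.exp_pos _) (Real.sin_pos_of_pos_of_lt_pi h1 h2)

/-- `G` is holomorphic on the strip `0 < Im ζ < π` when `ψ` is holomorphic on `ℍ`. [folklore] -/
theorem differentiableOn_logIntegrand {ψ : ℂ → ℂ} (hψ : DifferentiableOn ℂ ψ {w | 0 < w.im}) :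
    DifferentiableOn ℂ (logIntegrand ψ) {ζ | 0 < ζ.im ∧ ζ.im < π} := by
  intro ζ hζ
  have hexp : DifferentiableWithinAt ℂ cexp {ζ | 0 < ζ.im ∧ ζ.im < π} ζ :=
    Complex.differentiable_exp.differentiableAt.differentiableWithinAt
  refine DifferentiableWithinAt.mul ?_ hexp
  exact (hψ _ (im_exp_pos_of_mem_strip hζ.1 hζ.2)).comp _ hexp
    (fun ξ hξ ↦ im_exp_pos_of_mem_strip hξ.1 hξ.2)

/-- The rectangle `[[a, b]] × [[θ₁, θ₂]]` lies in the strip when `θ₁, θ₂ ∈ (0, π)`. [folklore] -/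
theorem reProdIm_subset_strip (a b : ℝ) {θ₁ θ₂ : ℝ} (hθ₁ : θ₁ ∈ Ioo 0 π) (hθ₂ : θ₂ ∈ Ioo 0 π) :
    ([[a, b]] ×ℂ [[θ₁, θ₂]]) ⊆ {ζ | 0 < ζ.im ∧ ζ.im < π} := by
  intro ζ hζ
  rw [mem_reProdIm] at hζ
  have hi : ζ.im ∈ [[θ₁, θ₂]] := hζ.2
  rcases mem_uIcc.mp hi with ⟨ha, hb⟩ | ⟨ha, hb⟩
  · exact ⟨hθ₁.1.trans_le ha, hb.trans_lt hθ₂.2⟩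
  · exact ⟨hθ₂.1.trans_le ha, hb.trans_lt hθ₁.2⟩

/-- **Ray integrals of an invariant holomorphic differential are independent of the angle**: if
`ψ` is holomorphic on `ℍ` and `ψ(λw) λ = ψ(w)` with `λ = r₂/r₁` (i.e. `ψ(w) dw` is invariant under
the hyperbolic dilation `w ↦ λ w`), then `θ ↦ ∫_{r₁}^{r₂} ψ(re^{iθ}) e^{iθ} dr` is constant on `(0, π)`
(Cauchy's theorem on the rectangle `[log r₁, log r₂] × [θ₁, θ₂]` in `ζ = log w`; the vertical sides
cancel by invariance). In Shintani's computation: the integral over `Γ_x∖ℍ` of an indefinite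
anisotropic form only sees the cycle integral of `φ` over the closed geodesic of `x`.
[cite: Shintani1975, §2, proof of Prop. 2.3] -/
theorem rayIntegral_eq_of_invariant {ψ : ℂ → ℂ} (hψ : DifferentiableOn ℂ ψ {w | 0 < w.im})
    {r₁ r₂ : ℝ} (h1 : 0 < r₁) (h2 : 0 < r₂)
    (hinv : ∀ w : ℂ, 0 < w.im → ψ (((r₂ / r₁ : ℝ) : ℂ) * w) * ((r₂ / r₁ : ℝ) : ℂ) = ψ w)
    {θ₁ θ₂ : ℝ} (hθ₁ : θ₁ ∈ Ioo 0 π) (hθ₂ : θ₂ ∈ Ioo 0 π) :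
    rayIntegral ψ θ₁ r₁ r₂ = rayIntegral ψ θ₂ r₁ r₂ := by
  set z : ℂ := ⟨Real.log r₁, θ₁⟩
  set w : ℂ := ⟨Real.log r₂, θ₂⟩
  have key := Complex.integral_boundary_rect_eq_zero_of_differentiableOn (logIntegrand ψ) z w
    ((differentiableOn_logIntegrand hψ).mono (reProdIm_subset_strip _ _ hθ₁ hθ₂))
  have hzre : z.re = Real.log r₁ := rfl
  have hwre : w.re = Real.log r₂ := rfl
  have hzim : z.im = θ₁ := rfl
  have hwim : w.im = θ₂ := rfl
  simp only [hzre, hwre, hzim, hwim] at key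
  rw [integral_logIntegrand_horizontal ψ θ₁ h1 h2, integral_logIntegrand_horizontal ψ θ₂ h1 h2] at key
  -- the vertical sides agree by invariance
  have hside : ∫ y in θ₁..θ₂, logIntegrand ψ ((Real.log r₂ : ℂ) + (y : ℂ) * I) =
      ∫ y in θ₁..θ₂, logIntegrand ψ ((Real.log r₁ : ℂ) + (y : ℂ) * I) := by
    refine intervalIntegral.integral_congr fun y hy ↦ ?_
    have hy' : 0 < y ∧ y < π := by
      rcases mem_uIcc.mp hy with ⟨ha, hb⟩ | ⟨ha, hb⟩
      · exact ⟨hθ₁.1.trans_le ha, hb.trans_lt hθ₂.2⟩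
      · exact ⟨hθ₂.1.trans_le ha, hb.trans_lt hθ₁.2⟩
    simp only [logIntegrand_log_add ψ h2, logIntegrand_log_add ψ h1]
    have him : 0 < (polarPt r₁ y).im := by
      rw [polarPt_im]; exact mul_pos h1 (Real.sin_pos_of_pos_of_lt_pi hy'.1 hy'.2)
    have hscale : polarPt r₂ y = ((r₂ / r₁ : ℝ) : ℂ) * polarPt r₁ y := by
      rw [polarPt, polarPt, ← mul_assoc, ← ofReal_mul, div_mul_cancel₀ _ h1.ne']
    rw [hscale, ← hinv _ him]
    ring
  rw [hside] at key
  linear_combination key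

/-- `sin` on `[[θ₁, θ₂]] ⊆ [0, π]` is bounded below by its values at the endpoints (concavity).
[folklore] -/
theorem min_sin_le_sin_of_mem_uIcc {θ₁ θ₂ y : ℝ} (h1 : θ₁ ∈ Icc 0 π) (h2 : θ₂ ∈ Icc 0 π)
    (hy : y ∈ [[θ₁, θ₂]]) : min (Real.sin θ₁) (Real.sin θ₂) ≤ Real.sin y :=
  strictConcaveOn_sin_Icc.concaveOn.ge_on_segment h1 h2 (by rwa [segment_eq_uIcc])

/-- **The invariant bound in log coordinates**: if `‖ψ(w)‖ Im w ≤ C` on `ℍ` (for a cusp form of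
weight `2` and all its `SL₂(ℝ)`-translates) then `‖G(s + iy)‖ ≤ C / sin y` for `0 < y < π`. [folklore] -/
theorem norm_logIntegrand_le {ψ : ℂ → ℂ} {C : ℝ} (hC : ∀ w : ℂ, 0 < w.im → ‖ψ w‖ * w.im ≤ C)
    (s : ℝ) {y : ℝ} (hy : y ∈ Ioo 0 π) :
    ‖logIntegrand ψ ((s : ℂ) + (y : ℂ) * I)‖ ≤ C / Real.sin y := by
  have hsin : 0 < Real.sin y := Real.sin_pos_of_pos_of_lt_pi hy.1 hy.2
  rw [logIntegrand, exp_ofReal_add_mul_I, norm_mul, norm_polarPt, abs_of_pos (Real.exp_pos s),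
    le_div_iff₀ hsin]
  have him : 0 < (polarPt (Real.exp s) y).im := by
    rw [polarPt_im]; exact mul_pos (Real.exp_pos s) hsin
  have := hC _ him
  rw [polarPt_im] at this
  linarith

/-- The vertical sides of the rectangles tend to `0`: dominated convergence with the constant bound
`C / min(sin θ₁, sin θ₂)` and the pointwise decay of `ψ(w) w` along rays (`ρ = ±T`). [folklore] -/
theorem tendsto_integral_logIntegrand_vertical {ψ : ℂ → ℂ} (hψ : DifferentiableOn ℂ ψ {w | 0 < w.im})
    {C : ℝ} (hC : ∀ w : ℂ, 0 < w.im → ‖ψ w‖ * w.im ≤ C)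
    {ρ : ℝ → ℝ} {l : Filter ℝ} [l.IsCountablyGenerated] [l.NeBot]
    (hlim : ∀ y ∈ Ioo 0 π,
      Tendsto (fun T ↦ ψ (polarPt (Real.exp (ρ T)) y) * polarPt (Real.exp (ρ T)) y) l (𝓝 0))
    {θ₁ θ₂ : ℝ} (hθ₁ : θ₁ ∈ Ioo 0 π) (hθ₂ : θ₂ ∈ Ioo 0 π) :
    Tendsto (fun T ↦ ∫ y in θ₁..θ₂, logIntegrand ψ ((ρ T : ℂ) + (y : ℂ) * I)) l (𝓝 0) := by
  set m : ℝ := min (Real.sin θ₁) (Real.sin θ₂) with hm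
  have hm0 : 0 < m := lt_min (Real.sin_pos_of_pos_of_lt_pi hθ₁.1 hθ₁.2)
    (Real.sin_pos_of_pos_of_lt_pi hθ₂.1 hθ₂.2)
  have hC0 : 0 ≤ C := by
    have := hC I (by simp)
    simp at this
    exact le_trans (by positivity) this
  have hIoo : ∀ y ∈ Ι θ₁ θ₂, y ∈ Ioo 0 π := fun y hy ↦ by
    have hy' : y ∈ [[θ₁, θ₂]] := uIoc_subset_uIcc hy
    rcases mem_uIcc.mp hy' with ⟨ha, hb⟩ | ⟨ha, hb⟩
    · exact ⟨hθ₁.1.trans_le ha, hb.trans_lt hθ₂.2⟩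
    · exact ⟨hθ₂.1.trans_le ha, hb.trans_lt hθ₁.2⟩
  have hcont : ∀ T, ContinuousOn (fun y : ℝ ↦ logIntegrand ψ ((ρ T : ℂ) + (y : ℂ) * I)) (Ι θ₁ θ₂) := by
    intro T
    have hline : Continuous fun y : ℝ ↦ ((ρ T : ℂ) + (y : ℂ) * I) := by fun_prop
    have hmaps : MapsTo (fun y : ℝ ↦ cexp ((ρ T : ℂ) + (y : ℂ) * I)) (Ι θ₁ θ₂) {w | 0 < w.im} := by
      intro y hy
      have := hIoo y hy
      show 0 < (cexp ((ρ T : ℂ) + (y : ℂ) * I)).im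
      rw [exp_ofReal_add_mul_I, polarPt_im]
      exact mul_pos (Real.exp_pos _) (Real.sin_pos_of_pos_of_lt_pi this.1 this.2)
    have hexp : Continuous fun y : ℝ ↦ cexp ((ρ T : ℂ) + (y : ℂ) * I) :=
      Complex.continuous_exp.comp hline
    exact (hψ.continuousOn.comp hexp.continuousOn hmaps).mul hexp.continuousOn
  have key := intervalIntegral.tendsto_integral_filter_of_dominated_convergence (μ := volume)
    (l := l) (F := fun T y ↦ logIntegrand ψ ((ρ T : ℂ) + (y : ℂ) * I)) (f := fun _ ↦ 0)
    (a := θ₁) (b := θ₂) (fun _ ↦ C / m)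
    (Eventually.of_forall fun T ↦ (hcont T).aestronglyMeasurable measurableSet_uIoc)
    (Eventually.of_forall fun T ↦ ae_of_all _ fun y hy ↦ ?_)
    intervalIntegrable_const
    (ae_of_all _ fun y hy ↦ ?_)
  · simpa using key
  · -- the bound
    have hy' := hIoo y hy
    have hsin : 0 < Real.sin y := Real.sin_pos_of_pos_of_lt_pi hy'.1 hy'.2
    calc ‖logIntegrand ψ ((ρ T : ℂ) + (y : ℂ) * I)‖ ≤ C / Real.sin y := norm_logIntegrand_le hC _ hy'
      _ ≤ C / m := by
        apply div_le_div_of_nonneg_left hC0 hm0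
        exact min_sin_le_sin_of_mem_uIcc ⟨hθ₁.1.le, hθ₁.2.le⟩ ⟨hθ₂.1.le, hθ₂.2.le⟩
          (uIoc_subset_uIcc hy)
  · -- the pointwise limit
    simp only [logIntegrand_eq_comp_exp]
    exact hlim y (hIoo y hy)

/-- **Ray integrals from `0` to `∞` of a holomorphic differential decaying at both ends are
independent of the angle**: if `ψ` is holomorphic on `ℍ`, `‖ψ(w)‖ Im w` is bounded (the invariant
bound of a cusp form), `ψ(w) w → 0` along every ray as `|w| → 0` and as `|w| → ∞`, and `ψ` is
integrable along rays, then `∫₀^∞ ψ(re^{iθ}) e^{iθ} dr` does not depend on `θ ∈ (0, π)` (Cauchy's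
theorem on `[-T, T] × [θ₁, θ₂]` in `ζ = log w`, `T → ∞`). This is the case of SPLIT forms (cycle
from cusp to cusp) in Shintani's computation. [cite: Shintani1975, §2, proof of Prop. 2.4] -/
theorem integral_Ioi_ray_eq_of_decay {ψ : ℂ → ℂ} (hψ : DifferentiableOn ℂ ψ {w | 0 < w.im})
    {C : ℝ} (hC : ∀ w : ℂ, 0 < w.im → ‖ψ w‖ * w.im ≤ C)
    (h0 : ∀ y ∈ Ioo 0 π, Tendsto (fun r : ℝ ↦ ψ (polarPt r y) * polarPt r y) (𝓝[>] 0) (𝓝 0))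
    (hinf : ∀ y ∈ Ioo 0 π, Tendsto (fun r : ℝ ↦ ψ (polarPt r y) * polarPt r y) atTop (𝓝 0))
    (hint : ∀ θ ∈ Ioo 0 π, IntegrableOn (fun r : ℝ ↦ ψ (polarPt r θ) * unitAt θ) (Ioi 0))
    {θ₁ θ₂ : ℝ} (hθ₁ : θ₁ ∈ Ioo 0 π) (hθ₂ : θ₂ ∈ Ioo 0 π) :
    ∫ r in Ioi 0, ψ (polarPt r θ₁) * unitAt θ₁ = ∫ r in Ioi 0, ψ (polarPt r θ₂) * unitAt θ₂ := by
  rw [integral_Ioi_ray_eq_integral_logIntegrand, integral_Ioi_ray_eq_integral_logIntegrand]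
  set F : ℝ → ℝ → ℂ := fun θ s ↦ logIntegrand ψ ((s : ℂ) + (θ : ℂ) * I) with hF
  -- the rectangle identity for every `T`
  have hrect : ∀ T : ℝ, (∫ s in -T..T, F θ₁ s) - (∫ s in -T..T, F θ₂ s)
      + I • (∫ y in θ₁..θ₂, logIntegrand ψ ((T : ℂ) + (y : ℂ) * I))
      - I • (∫ y in θ₁..θ₂, logIntegrand ψ (((-T : ℝ) : ℂ) + (y : ℂ) * I)) = 0 := by
    intro T
    set z : ℂ := ⟨-T, θ₁⟩
    set w : ℂ := ⟨T, θ₂⟩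
    have key := Complex.integral_boundary_rect_eq_zero_of_differentiableOn (logIntegrand ψ) z w
      ((differentiableOn_logIntegrand hψ).mono (reProdIm_subset_strip _ _ hθ₁ hθ₂))
    have hzre : z.re = -T := rfl
    have hwre : w.re = T := rfl
    have hzim : z.im = θ₁ := rfl
    have hwim : w.im = θ₂ := rfl
    simp only [hzre, hwre, hzim, hwim] at key
    simpa using key
  -- limits of the four terms
  have hH : ∀ {θ : ℝ}, θ ∈ Ioo 0 π →
      Tendsto (fun T : ℝ ↦ ∫ s in -T..T, F θ s) atTop (𝓝 (∫ s, F θ s)) := fun hθ ↦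
    intervalIntegral_tendsto_integral (integrable_logIntegrand_of_integrableOn (hint _ hθ))
      tendsto_neg_atTop_atBot tendsto_id
  have hplus : Tendsto (fun T : ℝ ↦ ∫ y in θ₁..θ₂, logIntegrand ψ ((T : ℂ) + (y : ℂ) * I))
      atTop (𝓝 0) :=
    tendsto_integral_logIntegrand_vertical hψ hC (ρ := fun T ↦ Real.log (Real.exp T)) (l := atTop)
      (fun y hy ↦ by
        simp only [Real.log_exp]
        exact (hinf y hy).comp Real.tendsto_exp_atTop) hθ₁ hθ₂
      |>.congr (fun T ↦ by simp [Real.log_exp])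
  have hminus : Tendsto (fun T : ℝ ↦ ∫ y in θ₁..θ₂, logIntegrand ψ (((-T : ℝ) : ℂ) + (y : ℂ) * I))
      atTop (𝓝 0) :=
    tendsto_integral_logIntegrand_vertical hψ hC (ρ := fun T ↦ Real.log (Real.exp (-T))) (l := atTop)
      (fun y hy ↦ by
        simp only [Real.log_exp]
        exact (h0 y hy).comp (Real.tendsto_exp_atBot_nhdsGT.comp tendsto_neg_atTop_atBot)) hθ₁ hθ₂
      |>.congr (fun T ↦ by simp [Real.log_exp])
  have hlim : Tendsto (fun T : ℝ ↦ (∫ s in -T..T, F θ₁ s) - (∫ s in -T..T, F θ₂ s)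
      + I • (∫ y in θ₁..θ₂, logIntegrand ψ ((T : ℂ) + (y : ℂ) * I))
      - I • (∫ y in θ₁..θ₂, logIntegrand ψ (((-T : ℝ) : ℂ) + (y : ℂ) * I))) atTop
      (𝓝 ((∫ s, F θ₁ s) - (∫ s, F θ₂ s) + I • 0 - I • 0)) :=
    (((hH hθ₁).sub (hH hθ₂)).add (hplus.const_smul I)).sub (hminus.const_smul I)
  have hzero : Tendsto (fun T : ℝ ↦ (∫ s in -T..T, F θ₁ s) - (∫ s in -T..T, F θ₂ s)
      + I • (∫ y in θ₁..θ₂, logIntegrand ψ ((T : ℂ) + (y : ℂ) * I))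
      - I • (∫ y in θ₁..θ₂, logIntegrand ψ (((-T : ℝ) : ℂ) + (y : ℂ) * I))) atTop (𝓝 0) := by
    simp only [hrect]
    exact tendsto_const_nhds
  have := tendsto_nhds_unique hlim hzero
  simp only [smul_zero, add_zero, sub_zero] at this
  exact sub_eq_zero.mp this

/-! ### Integrability on an annulus from the invariant bound -/

/-- `e^{-c x²} (1 + x²)² ≤ 1 + 2/c + 2/c²` for `c > 0` (from `e^{cx²} ≥ 1 + cx² + c²x⁴/2`). [folklore] -/
theorem exp_neg_mul_sq_mul_le {c : ℝ} (hc : 0 < c) (x : ℝ) :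
    Real.exp (-c * x ^ 2) * (1 + x ^ 2) ^ 2 ≤ 1 + 2 / c + 2 / c ^ 2 := by
  have hy : 0 ≤ c * x ^ 2 := by positivity
  have e0 : (1 : ℝ) ≤ Real.exp (c * x ^ 2) := Real.one_le_exp hy
  have e1 : c * x ^ 2 ≤ Real.exp (c * x ^ 2) := by
    have := Real.add_one_le_exp (c * x ^ 2); linarith
  have e2 : (c * x ^ 2) ^ 2 / 2 ≤ Real.exp (c * x ^ 2) := by
    have := Real.pow_div_factorial_le_exp (c * x ^ 2) hy 2
    simpa [Nat.factorial] using this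
  rw [neg_mul, Real.exp_neg, inv_mul_le_iff₀ (Real.exp_pos _)]
  -- `(1 + x²)² = 1 + 2x² + x⁴ ≤ e + (2/c) e + (2/c²) e`
  have hx2 : x ^ 2 ≤ Real.exp (c * x ^ 2) / c := by
    rw [le_div_iff₀ hc]; linarith
  have hx4 : x ^ 4 ≤ 2 * Real.exp (c * x ^ 2) / c ^ 2 := by
    rw [le_div_iff₀ (by positivity)]; nlinarith
  have hc2 : (0:ℝ) < c ^ 2 := by positivity
  calc (1 + x ^ 2) ^ 2 = 1 + 2 * x ^ 2 + x ^ 4 := by ring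
    _ ≤ Real.exp (c * x ^ 2) + 2 * (Real.exp (c * x ^ 2) / c) + 2 * Real.exp (c * x ^ 2) / c ^ 2 := by
        linarith
    _ = Real.exp (c * x ^ 2) * (1 + 2 / c + 2 / c ^ 2) := by
        field_simp

/-- **`e^{-c cot²θ} / sin³θ ≤ 1 + 2/c + 2/c²` on `(0, π)`** (`c > 0`): with `x = cot θ`,
`1/sin²θ = 1 + x²` and `sin θ ≤ 1`, so the left side is at most `e^{-cx²}(1+x²)²`. [folklore] -/
theorem exp_neg_mul_cot_sq_div_sin_pow_three_le {c : ℝ} (hc : 0 < c) {θ : ℝ} (hθ : θ ∈ Ioo 0 π) :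
    Real.exp (-c * (Real.cos θ / Real.sin θ) ^ 2) / Real.sin θ ^ 3 ≤ 1 + 2 / c + 2 / c ^ 2 := by
  have hs : 0 < Real.sin θ := Real.sin_pos_of_pos_of_lt_pi hθ.1 hθ.2
  have hs1 : Real.sin θ ≤ 1 := Real.sin_le_one θ
  set x := Real.cos θ / Real.sin θ with hx
  have hs2 : Real.sin θ ^ 2 ≠ 0 := pow_ne_zero 2 hs.ne'
  have hx2 : 1 + x ^ 2 = 1 / Real.sin θ ^ 2 := by
    rw [hx, div_pow, eq_div_iff hs2, add_mul, one_mul, div_mul_cancel₀ _ hs2]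
    linarith [Real.sin_sq_add_cos_sq θ]
  have key := exp_neg_mul_sq_mul_le hc x
  rw [hx2, show (1 / Real.sin θ ^ 2) ^ 2 = 1 / Real.sin θ ^ 4 by
    rw [div_pow, one_pow, ← pow_mul], mul_one_div] at key
  calc Real.exp (-c * x ^ 2) / Real.sin θ ^ 3
      ≤ Real.exp (-c * x ^ 2) / Real.sin θ ^ 4 := by
        apply div_le_div_of_nonneg_left (Real.exp_pos _).le (by positivity)
        calc Real.sin θ ^ 4 = Real.sin θ ^ 3 * Real.sin θ := by ring
          _ ≤ Real.sin θ ^ 3 * 1 := by gcongr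
          _ = Real.sin θ ^ 3 := mul_one _
    _ ≤ 1 + 2 / c + 2 / c ^ 2 := key

/-- **Pointwise bound for the polar integrand** on `(r₁, ∞) × (0, π)` from the invariant bound
`‖ψ(w)‖ Im w ≤ C`: `‖polarIntegrand‖ ≤ C (1 + 2/c + 2/c²) / r₁`. [folklore] -/
theorem norm_polarIntegrand_le {ψ : ℂ → ℂ} {C c r₁ : ℝ} (hC : ∀ w : ℂ, 0 < w.im → ‖ψ w‖ * w.im ≤ C)
    (hc : 0 < c) (hr₁ : 0 < r₁) {p : ℝ × ℝ} (hr : r₁ ≤ p.1) (hθ : p.2 ∈ Ioo 0 π) :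
    ‖polarIntegrand ψ c p‖ ≤ C * (1 + 2 / c + 2 / c ^ 2) / r₁ := by
  have hs : 0 < Real.sin p.2 := Real.sin_pos_of_pos_of_lt_pi hθ.1 hθ.2
  have hrp : 0 < p.1 := hr₁.trans_le hr
  have hC0 : 0 ≤ C := by
    have := hC I (by simp)
    simp at this
    exact le_trans (by positivity) this
  have him : 0 < (polarPt p.1 p.2).im := by rw [polarPt_im]; positivity
  have hψ : ‖ψ (polarPt p.1 p.2)‖ ≤ C / (p.1 * Real.sin p.2) := by
    rw [le_div_iff₀ (by positivity)]
    have := hC _ him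
    rwa [polarPt_im] at this
  have hK := exp_neg_mul_cot_sq_div_sin_pow_three_le hc hθ
  rw [polarIntegrand, norm_mul, norm_mul, norm_unitAt, mul_one, Complex.norm_real,
    Real.norm_of_nonneg (by positivity)]
  calc Real.exp (-c * (Real.cos p.2 / Real.sin p.2) ^ 2) / Real.sin p.2 ^ 2 * ‖ψ (polarPt p.1 p.2)‖
      ≤ Real.exp (-c * (Real.cos p.2 / Real.sin p.2) ^ 2) / Real.sin p.2 ^ 2 * (C / (p.1 * Real.sin p.2)) := by
        gcongr
    _ = (Real.exp (-c * (Real.cos p.2 / Real.sin p.2) ^ 2) / Real.sin p.2 ^ 3) * C / p.1 := by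
        field_simp
    _ ≤ (1 + 2 / c + 2 / c ^ 2) * C / p.1 := by gcongr
    _ ≤ (1 + 2 / c + 2 / c ^ 2) * C / r₁ := by
        apply div_le_div_of_nonneg_left (by positivity) hr₁ hr
    _ = C * (1 + 2 / c + 2 / c ^ 2) / r₁ := by ring

/-- The polar integrand is continuous on `(0, ∞) × (0, π)` when `ψ` is continuous on `ℍ`. [folklore] -/
theorem continuousOn_polarIntegrand {ψ : ℂ → ℂ} (hψ : ContinuousOn ψ {w | 0 < w.im}) (c : ℝ) :
    ContinuousOn (polarIntegrand ψ c) (Ioi (0 : ℝ) ×ˢ Ioo 0 π) := by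
  have hpt : Continuous fun p : ℝ × ℝ ↦ polarPt p.1 p.2 := by
    unfold polarPt; fun_prop
  have hmaps : MapsTo (fun p : ℝ × ℝ ↦ polarPt p.1 p.2) (Ioi (0 : ℝ) ×ˢ Ioo 0 π) {w | 0 < w.im} := by
    intro p hp
    rw [mem_prod, mem_Ioi] at hp
    show 0 < (polarPt p.1 p.2).im
    rw [polarPt_im]
    exact mul_pos hp.1 (Real.sin_pos_of_pos_of_lt_pi hp.2.1 hp.2.2)
  have hψp : ContinuousOn (fun p : ℝ × ℝ ↦ ψ (polarPt p.1 p.2)) (Ioi (0 : ℝ) ×ˢ Ioo 0 π) :=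
    hψ.comp hpt.continuousOn hmaps
  have hunit : Continuous fun p : ℝ × ℝ ↦ unitAt p.2 := by unfold unitAt; fun_prop
  have hfac : ContinuousOn (fun p : ℝ × ℝ ↦
      ((Real.exp (-c * (Real.cos p.2 / Real.sin p.2) ^ 2) / Real.sin p.2 ^ 2 : ℝ) : ℂ))
      (Ioi (0 : ℝ) ×ˢ Ioo 0 π) := by
    set U : Set (ℝ × ℝ) := Ioi (0 : ℝ) ×ˢ Ioo 0 π
    have hne : ∀ p ∈ U, Real.sin p.2 ≠ 0 := fun p hp ↦ by
      rw [mem_prod] at hp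
      exact (Real.sin_pos_of_pos_of_lt_pi hp.2.1 hp.2.2).ne'
    have hsin : ContinuousOn (fun p : ℝ × ℝ ↦ Real.sin p.2) U :=
      (Real.continuous_sin.comp continuous_snd).continuousOn
    have hcos : ContinuousOn (fun p : ℝ × ℝ ↦ Real.cos p.2) U :=
      (Real.continuous_cos.comp continuous_snd).continuousOn
    have hcot : ContinuousOn (fun p : ℝ × ℝ ↦ Real.cos p.2 / Real.sin p.2) U := hcos.div hsin hne
    have hnum : ContinuousOn (fun p : ℝ × ℝ ↦ Real.exp (-c * (Real.cos p.2 / Real.sin p.2) ^ 2)) U :=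
      Real.continuous_exp.comp_continuousOn (continuousOn_const.mul (hcot.pow 2))
    have hreal : ContinuousOn
        (fun p : ℝ × ℝ ↦ Real.exp (-c * (Real.cos p.2 / Real.sin p.2) ^ 2) / Real.sin p.2 ^ 2) U :=
      hnum.div (hsin.pow 2) fun p hp ↦ pow_ne_zero _ (hne p hp)
    exact Complex.continuous_ofReal.comp_continuousOn hreal
  exact hfac.mul (hψp.mul hunit.continuousOn)

/-- **Integrability on an annulus** `(r₁, r₂) × (0, π)`, `0 < r₁`, from the invariant bound (bounded
integrand on a set of finite measure). [folklore] -/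
theorem integrableOn_polarIntegrand_annulus {ψ : ℂ → ℂ} (hψ : ContinuousOn ψ {w | 0 < w.im})
    {C c r₁ r₂ : ℝ} (hC : ∀ w : ℂ, 0 < w.im → ‖ψ w‖ * w.im ≤ C) (hc : 0 < c) (hr₁ : 0 < r₁) :
    IntegrableOn (polarIntegrand ψ c) (Ioo r₁ r₂ ×ˢ Ioo 0 π) := by
  have hmeas : MeasurableSet (Ioo r₁ r₂ ×ˢ Ioo (0 : ℝ) π) := measurableSet_Ioo.prod measurableSet_Ioo
  have hsub : Ioo r₁ r₂ ×ˢ Ioo (0 : ℝ) π ⊆ Ioi (0 : ℝ) ×ˢ Ioo 0 π :=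
    prod_mono (fun r hr ↦ hr₁.trans hr.1) Subset.rfl
  have hfin : volume (Ioo r₁ r₂ ×ˢ Ioo (0 : ℝ) π) ≠ ⊤ := by
    rw [Measure.volume_eq_prod, Measure.prod_prod]
    exact ENNReal.mul_ne_top measure_Ioo_lt_top.ne measure_Ioo_lt_top.ne
  haveI : IsFiniteMeasure (volume.restrict (Ioo r₁ r₂ ×ˢ Ioo (0 : ℝ) π)) :=
    isFiniteMeasure_restrict.mpr hfin
  refine Integrable.mono' (g := fun _ ↦ C * (1 + 2 / c + 2 / c ^ 2) / r₁) (integrable_const _)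
    (((continuousOn_polarIntegrand hψ c).mono hsub).aestronglyMeasurable hmeas) ?_
  refine (ae_restrict_iff' hmeas).mpr (ae_of_all _ fun p hp ↦ ?_)
  rw [mem_prod] at hp
  exact norm_polarIntegrand_le hC hc hr₁ hp.1.1.le hp.2

/-! ### The two evaluations -/

/-- **The hyperbolic orbit integral** (indefinite anisotropic forms): for `ψ` holomorphic on `ℍ`
with the invariant bound `‖ψ(w)‖ Im w ≤ C` and the invariance `ψ(λ w) λ = ψ(w)`, `λ = r₂/r₁ > 1`,
`∫_{Im w>0, r₁<|w|<r₂} (Im w)⁻² ψ(w) w e^{-c(Re w/Im w)²} dw = √(π/c) · ∫_{r₁}^{r₂} ψ(iy) i dy`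
(`c > 0`): the orbit integral is the cycle integral `∫_{i r₁}^{i r₂} ψ(w) dw` along the geodesic
times the transverse Gaussian. [cite: Shintani1975, §2, Prop. 2.3] -/
theorem integral_annulus_eq_rayIntegral_mul_sqrt {ψ : ℂ → ℂ} (hψ : DifferentiableOn ℂ ψ {w | 0 < w.im})
    {C c r₁ r₂ : ℝ} (hC : ∀ w : ℂ, 0 < w.im → ‖ψ w‖ * w.im ≤ C) (hc : 0 < c) (hr₁ : 0 < r₁)
    (hr₁₂ : r₁ ≤ r₂)
    (hinv : ∀ w : ℂ, 0 < w.im → ψ (((r₂ / r₁ : ℝ) : ℂ) * w) * ((r₂ / r₁ : ℝ) : ℂ) = ψ w) :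
    ∫ w in sectorSet (Ioo r₁ r₂), planeIntegrand ψ c w =
      rayIntegral ψ (π / 2) r₁ r₂ * (√(π / c) : ℝ) := by
  have hr₂ : 0 < r₂ := hr₁.trans_le hr₁₂
  refine integral_sectorSet_planeIntegrand_eq measurableSet_Ioo (fun r hr ↦ hr₁.trans hr.1)
    (integrableOn_polarIntegrand_annulus hψ.continuousOn hC hc hr₁) fun θ hθ ↦ ?_
  rw [← rayIntegral_eq_of_invariant hψ hr₁ hr₂ hinv hθ ⟨by positivity, by linarith [pi_pos]⟩,
    rayIntegral, intervalIntegral.integral_of_le hr₁₂]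
  exact setIntegral_congr_set Ioo_ae_eq_Ioc

/-- **The split orbit integral** (forms whose cycle joins two cusps): for `ψ` holomorphic on `ℍ`
with the invariant bound, decaying along rays at `0` and `∞` and integrable along rays, and with the
polar integrand integrable on `(0, ∞) × (0, π)`,
`∫_{Im w>0} (Im w)⁻² ψ(w) w e^{-c(Re w/Im w)²} dw = √(π/c) · ∫₀^∞ ψ(iy) i dy` — the complete period
of `ψ` from the cusp `0` to the cusp `∞` (a twisted `L`-value when `ψ = φ|g`) times the transverse
Gaussian. [cite: Shintani1975, §2, Prop. 2.4] -/
theorem integral_sectorSet_Ioi_eq_mul_sqrt {ψ : ℂ → ℂ} (hψ : DifferentiableOn ℂ ψ {w | 0 < w.im})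
    {C c : ℝ} (hC : ∀ w : ℂ, 0 < w.im → ‖ψ w‖ * w.im ≤ C)
    (h0 : ∀ y ∈ Ioo 0 π, Tendsto (fun r : ℝ ↦ ψ (polarPt r y) * polarPt r y) (𝓝[>] 0) (𝓝 0))
    (hinf : ∀ y ∈ Ioo 0 π, Tendsto (fun r : ℝ ↦ ψ (polarPt r y) * polarPt r y) atTop (𝓝 0))
    (hray : ∀ θ ∈ Ioo 0 π, IntegrableOn (fun r : ℝ ↦ ψ (polarPt r θ) * unitAt θ) (Ioi 0))
    (hint : IntegrableOn (polarIntegrand ψ c) (Ioi 0 ×ˢ Ioo 0 π)) :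
    ∫ w in sectorSet (Ioi 0), planeIntegrand ψ c w =
      (∫ r in Ioi 0, ψ (polarPt r (π / 2)) * unitAt (π / 2)) * (√(π / c) : ℝ) :=
  integral_sectorSet_planeIntegrand_eq measurableSet_Ioi Subset.rfl hint fun θ hθ ↦
    integral_Ioi_ray_eq_of_decay hψ hC h0 hinf hray hθ ⟨by positivity, by linarith [pi_pos]⟩

/-- At `θ = π/2` the ray is the imaginary axis: `polarPt r (π/2) = r i`, `unitAt (π/2) = i`. [folklore] -/
theorem polarPt_pi_div_two (r : ℝ) : polarPt r (π / 2) = (r : ℂ) * I := by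
  rw [polarPt, Real.cos_pi_div_two, Real.sin_pi_div_two]; push_cast; ring

/-- `e^{iπ/2} = i`. [folklore] -/
theorem unitAt_pi_div_two : unitAt (π / 2) = I := by
  rw [unitAt, Real.cos_pi_div_two, Real.sin_pi_div_two]; push_cast; ring

/-! ### The statement on Mathlib's upper half-plane -/

/-- The image in `ℂ` of the radial set `{τ ∈ ℍ : |τ| ∈ S}` is the sector set. [folklore] -/
theorem image_coe_radial (S : Set ℝ) :
    ((↑) : UpperHalfPlane → ℂ) '' {τ : UpperHalfPlane | ‖(τ : ℂ)‖ ∈ S} = sectorSet S := by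
  ext w
  constructor
  · rintro ⟨τ, hτ, rfl⟩
    exact ⟨τ.im_pos, hτ⟩
  · rintro ⟨hw, hS⟩
    exact ⟨⟨w, hw⟩, hS, rfl⟩

/-- The radial set `{τ ∈ ℍ : |τ| ∈ S}` is measurable. [folklore] -/
theorem measurableSet_radial {S : Set ℝ} (hS : MeasurableSet S) :
    MeasurableSet {τ : UpperHalfPlane | ‖(τ : ℂ)‖ ∈ S} :=
  (continuous_norm.comp UpperHalfPlane.continuous_coe).measurable hS

/-- **The hyperbolic orbit integral on `ℍ` with its invariant measure**:
`∫_{τ ∈ ℍ, r₁ < |τ| < r₂} ψ(τ) τ e^{-c (Re τ / Im τ)²} dμ(τ) = √(π/c) ∫_{r₁}^{r₂} ψ(iy) i dy` under the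
hypotheses of `integral_annulus_eq_rayIntegral_mul_sqrt` (`dμ = du dv / v²`, Mathlib's
`UpperHalfPlane.volume`). [cite: Shintani1975, §2, Prop. 2.3] -/
theorem setIntegral_upperHalfPlane_annulus_eq {ψ : ℂ → ℂ} (hψ : DifferentiableOn ℂ ψ {w | 0 < w.im})
    {C c r₁ r₂ : ℝ} (hC : ∀ w : ℂ, 0 < w.im → ‖ψ w‖ * w.im ≤ C) (hc : 0 < c) (hr₁ : 0 < r₁)
    (hr₁₂ : r₁ ≤ r₂)
    (hinv : ∀ w : ℂ, 0 < w.im → ψ (((r₂ / r₁ : ℝ) : ℂ) * w) * ((r₂ / r₁ : ℝ) : ℂ) = ψ w) :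
    ∫ τ in {τ : UpperHalfPlane | ‖(τ : ℂ)‖ ∈ Ioo r₁ r₂},
        ψ τ * (τ : ℂ) * (Real.exp (-c * ((τ : ℂ).re / (τ : ℂ).im) ^ 2) : ℂ) =
      rayIntegral ψ (π / 2) r₁ r₂ * (√(π / c) : ℝ) := by
  rw [Literature.NumberTheory.EllipticCurves.ModularForms.FdCoord.setIntegral_eq_setIntegral_image _
    (measurableSet_radial measurableSet_Ioo), image_coe_radial,
    ← integral_annulus_eq_rayIntegral_mul_sqrt hψ hC hc hr₁ hr₁₂ hinv]
  refine setIntegral_congr_fun (measurableSet_sectorSet measurableSet_Ioo) fun w hw ↦ ?_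
  rw [planeIntegrand, UpperHalfPlane.ofComplex_apply_of_im_pos hw.1]

end Literature.NumberTheory.EllipticCurves.Shintani

end
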